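import Literature.Analysis.FluidPDE.PassiveVectorTensorPropagatorUnique
import Literature.Analysis.FluidPDE.PassiveVectorTensorEnergyDecay
import Literature.Analysis.FluidPDE.PassiveVectorTensorGalerkinTail
import Literature.Analysis.FluidPDE.NSHopfLimit
import Literature.Analysis.FluidPDE.NSUniqueness2HalfDEstimates
import Mathlib.MeasureTheory.Measure.OpenPos
import HarnessLib

/-!
# Energy bookkeeping of the solution propagator along a window (contraction monotonicity, drop ≥ dissipation, fast-mode kill)

Analysis/FluidPDE file (all proofs, no definitions, no named facts).  For the two-parameter propagator of the linear tensor passive-vector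
problem (`PassiveVectorTensorPropagator`: `Torus.propagator`, spec `Torus.IsPropagator`; `…Unique`: the spec determines it) under the standing
hypotheses (`NearIso 𝔸 lo hi`, `0 < lo`, `stLift b ∈ L^∞((0,T) × T^d)`, `b` a.e. weakly divergence free):

* (E1) `IsPropagator.norm_apply_le_of_le` — MONOTONE: `‖U s t y‖ ≤ ‖U s t′ y‖` for `s ≤ t′ ≤ t` (cocycle + contraction);
* (E2) `propagator_energy_ineq` / `IsPropagator.energy_ineq` — DROP ≥ DISSIPATION AT EVERY TIME:
  `ofReal ‖U s t y‖² + 2·eVectorDissipation lo w 0 (t − s) ≤ ofReal ‖P_σ y‖²` where `w = windowSol …` is the chosen Lions weak solution on `[s,T)`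
  from `P_σ y` (whose weakly continuous representative gives the values of `U`, `coeFn_propagator`); the class's a.e. energy inequality
  (`ae_energy_ineq`, Temam III.1.2) is transported to EVERY `t` through the weakly continuous representative (pairings against `L²` tests are
  continuous in `t`, the dissipation primitive is continuous in `t`, an a.e. inequality between continuous functions holds everywhere, and
  `‖W‖ ≤ √h` follows by testing against `W` itself); real form `two_mul_lo_mul_dissipation_le_drop`;
* (E3) `propagator_fast_kill` / `IsPropagator.fast_kill` — HIGH-MODE COROLLARY: `2·lo·4π²N²·∫₀^{t−s} ‖(1 − P_N) w(τ)‖² dτ ≤ ‖P_σ y‖² − ‖U s t y‖²`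
  (spectral gap `4π²N²‖u − P_N u‖² ≤ ‖∇u‖²` off the Fourier ball, `ofReal_mul_lintegral_sub_fourierTruncate_le_eGradNormSq`).

Cell `ad-ideate`, crux K1L_D, lead `lead-k1l-onelevel-p1` brick (i) (17:57:51Z): the propagator-side half of the window ledger's dissipation floor.

## References
* R. Temam, *Navier–Stokes Equations* (1984), Ch. III §1 Lemma 1.2 (energy inequality), Lemma 1.4 (weak continuity). [`Temam1984`]
* A. Pazy, *Semigroups of Linear Operators* (1983), Ch. 5 §5.1. [`Pazy1983`]
-/

noncomputable section

open MeasureTheory Set Filter Function TopologicalSpace UnitAddTorus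
open scoped ENNReal NNReal InnerProductSpace Topology

namespace Literature.Analysis.FluidPDE

namespace Torus

variable {d : Type*} [Fintype d] [DecidableEq d] [Nonempty d]
variable {T : ℝ} {𝔸 : Visc4 d} {lo hi : ℝ} {b : ℝ → UnitAddTorus d → EuclideanSpace ℝ d}

/-! ## Tools -/

omit [Fintype d] [DecidableEq d] [Nonempty d] in
/-- An a.e. inequality between two functions continuous on `[a,c]` holds everywhere on `[a,c]`. [cite: Temam1984, Ch. III §1 Lemma 1.4] -/
theorem le_on_Icc_of_ae_le_of_continuousOn₂ {f g : ℝ → ℝ} {a c : ℝ} (hac : a < c) (hf : ContinuousOn f (Icc a c))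
    (hg : ContinuousOn g (Icc a c)) (h : ∀ᵐ x ∂(volume.restrict (Ioo a c)), f x ≤ g x) :
    ∀ x ∈ Icc a c, f x ≤ g x := by
  have hmin : ContinuousOn (fun x => min (f x) (g x)) (Icc a c) := hf.inf hg
  have hae : (fun x => min (f x) (g x)) =ᵐ[volume.restrict (Icc a c)] f := by
    rw [Measure.restrict_congr_set Ioo_ae_eq_Icc.symm]
    filter_upwards [h] with x hx
    exact min_eq_left hx
  have heq := Measure.eqOn_Icc_of_ae_eq (volume : Measure ℝ) hac.ne hae hmin hf
  intro x hx
  have e := heq hx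
  simp only at e
  rw [← e]
  exact min_le_right _ _

omit [DecidableEq d] [Nonempty d] in
/-- `‖toLp f‖² = ∫‖f‖²` for `f ∈ L²`. [folklore] -/
private theorem norm_toLp_sq' {f : UnitAddTorus d → EuclideanSpace ℝ d} (hf : MemLp f 2 volume) :
    ‖hf.toLp f‖ ^ 2 = ∫ x, ‖f x‖ ^ 2 := by
  rw [← real_inner_self_eq_norm_sq, MeasureTheory.L2.inner_def]
  refine integral_congr_ae ?_
  filter_upwards [hf.coeFn_toLp] with x hx
  rw [hx, real_inner_self_eq_norm_sq]

omit [DecidableEq d] [Nonempty d] in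
/-- Cauchy–Schwarz for the `L²` pairing: `|∫⟪f, g⟫| ≤ √(∫‖f‖²)·√(∫‖g‖²)`. [folklore] -/
private theorem abs_integral_inner_le_sqrt_mul_sqrt {f g : UnitAddTorus d → EuclideanSpace ℝ d} (hf : MemLp f 2 volume)
    (hg : MemLp g 2 volume) :
    |∫ x, ⟪f x, g x⟫_ℝ| ≤ Real.sqrt (∫ x, ‖f x‖ ^ 2) * Real.sqrt (∫ x, ‖g x‖ ^ 2) := by
  have e : ∫ x, ⟪f x, g x⟫_ℝ = ⟪hf.toLp f, hg.toLp g⟫_ℝ := by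
    rw [MeasureTheory.L2.inner_def]
    refine integral_congr_ae ?_
    filter_upwards [hf.coeFn_toLp, hg.coeFn_toLp] with x hx hy
    rw [hx, hy]
  have hf' : ‖hf.toLp f‖ = Real.sqrt (∫ x, ‖f x‖ ^ 2) := by
    rw [← norm_toLp_sq' hf, Real.sqrt_sq (norm_nonneg _)]
  have hg' : ‖hg.toLp g‖ = Real.sqrt (∫ x, ‖g x‖ ^ 2) := by
    rw [← norm_toLp_sq' hg, Real.sqrt_sq (norm_nonneg _)]
  rw [e, ← hf', ← hg']
  exact abs_real_inner_le_norm _ _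

omit [Nonempty d] in
/-- **Spectral gap off the Fourier ball**: `4π²N² · ∫‖u − P_N u‖² ≤ ‖∇u‖²` for `u ∈ L²` (every mode off the ball has `|k|² > N²`; Parseval).
[cite: Temam1984, Ch. III §1 Lemma 1.2] -/
theorem ofReal_mul_lintegral_sub_fourierTruncate_le_eGradNormSq {u : UnitAddTorus d → EuclideanSpace ℝ d} (hu : MemLp u 2 volume) (N : ℕ) :
    ENNReal.ofReal (4 * Real.pi ^ 2 * (N : ℝ) ^ 2) * ∫⁻ x, ‖u x - FunctionSpaces.Torus.fourierTruncate N u x‖ₑ ^ 2 ≤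
      FunctionSpaces.Torus.eGradNormSq u := by
  classical
  have e1 : ∫⁻ x, ‖u x - FunctionSpaces.Torus.fourierTruncate N u x‖ₑ ^ 2 =
      ∫⁻ x, ‖FunctionSpaces.Torus.fourierTruncate N u x - u x‖ₑ ^ 2 :=
    lintegral_congr fun x => by rw [← enorm_neg, neg_sub]
  rw [e1, FunctionSpaces.Torus.lintegral_enorm_sq_fourierTruncate_sub hu N, ← ENNReal.tsum_mul_left]
  calc (∑' k : {k : d → ℤ // k ∉ FunctionSpaces.Torus.freqBall N},
        ENNReal.ofReal (4 * Real.pi ^ 2 * (N : ℝ) ^ 2) * ‖mFourierCoeff (FunctionSpaces.EuclideanSpace.complexify ∘ u) k‖ₑ ^ 2)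
      ≤ ∑' k : {k : d → ℤ // k ∉ FunctionSpaces.Torus.freqBall N},
        ENNReal.ofReal (4 * Real.pi ^ 2) * (ENNReal.ofReal (FunctionSpaces.Torus.freqNormSq (k : d → ℤ)) *
          ‖mFourierCoeff (FunctionSpaces.EuclideanSpace.complexify ∘ u) k‖ₑ ^ 2) := by
        refine ENNReal.tsum_le_tsum fun k => ?_
        rw [← mul_assoc, ENNReal.ofReal_mul (by positivity)]
        gcongr
        exact (FunctionSpaces.Torus.not_mem_freqBall.1 k.2).le
    _ ≤ ∑' k : d → ℤ, ENNReal.ofReal (4 * Real.pi ^ 2) * (ENNReal.ofReal (FunctionSpaces.Torus.freqNormSq k) *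
          ‖mFourierCoeff (FunctionSpaces.EuclideanSpace.complexify ∘ u) k‖ₑ ^ 2) :=
        ENNReal.tsum_comp_le_tsum_of_injective Subtype.val_injective
          (fun k : d → ℤ => ENNReal.ofReal (4 * Real.pi ^ 2) * (ENNReal.ofReal (FunctionSpaces.Torus.freqNormSq k) *
            ‖mFourierCoeff (FunctionSpaces.EuclideanSpace.complexify ∘ u) k‖ₑ ^ 2))
    _ = FunctionSpaces.Torus.eGradNormSq u := by
        rw [FunctionSpaces.Torus.eGradNormSq_eq_tsum, ENNReal.tsum_mul_left]

omit [Nonempty d] in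
/-- Time-measurability of the dissipation density `τ ↦ ‖∇w(τ)‖²` of a weak solution (Galerkin coefficients are measurable in time).
[cite: Temam1984, Ch. III §1 Lemma 1.2] -/
theorem IsWeakTensorPassiveVectorOn.aemeasurable_eGradNormSq' {A : ℝ} {w₀ : UnitAddTorus d → EuclideanSpace ℝ d}
    {w : ℝ → UnitAddTorus d → EuclideanSpace ℝ d} (h : IsWeakTensorPassiveVectorOn A T 𝔸 b w₀ w) :
    AEMeasurable (fun τ => FunctionSpaces.Torus.eGradNormSq (w τ)) (volume.restrict (Ioo 0 T)) :=
  Torus.aemeasurable_eGradNormSq_of_coeff fun k =>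
    Torus.aestronglyMeasurable_mFourierCoeff_complexify_slice h.aestronglyMeasurable_uncurry k

/-! ## (E1) Monotonicity -/

namespace IsPropagator

variable {U : ℝ → ℝ → (Lp (EuclideanSpace ℝ d) 2 (volume : Measure (UnitAddTorus d)) →L[ℝ]
  Lp (EuclideanSpace ℝ d) 2 (volume : Measure (UnitAddTorus d)))}

omit [Nonempty d] in
/-- **(E1) MONOTONE ENERGY**: `‖U s t y‖ ≤ ‖U s t′ y‖` for `0 ≤ s ≤ t′ ≤ t ≤ T` (cocycle `U s t = U t′ t ∘ U s t′` + contraction).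
[cite: Pazy1983, Ch. 5 §5.1 Def. 5.3] -/
theorem norm_apply_le_of_le (hU : IsPropagator T b 𝔸 U) {s t' t : ℝ} (hs : 0 ≤ s) (hst' : s ≤ t') (ht't : t' ≤ t) (htT : t ≤ T)
    (y : Lp (EuclideanSpace ℝ d) 2 (volume : Measure (UnitAddTorus d))) :
    ‖U s t y‖ ≤ ‖U s t' y‖ := by
  rw [← hU.comp s t' t hs hst' ht't htT y]
  exact hU.norm_le _ _ _

end IsPropagator

/-! ## (E2) Drop ≥ dissipation at EVERY time -/

section Energy

variable (h𝔸 : NearIso 𝔸 lo hi) (hlo : 0 < lo)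
  (hb : MemLp (FunctionSpaces.Torus.stLift b) ∞ (volume.restrict (Ioo 0 T ×ˢ univ)))
  (hbdiv : ∀ᵐ τ ∂(volume.restrict (Ioo 0 T)), FunctionSpaces.Torus.IsWeaklyDivFree (b τ))

include h𝔸 hlo hb hbdiv

omit [DecidableEq d] [Nonempty d] h𝔸 hlo hbdiv in
/-- The shifted carrier is essentially bounded on the window `(0, T − s) × T^d`. [folklore] -/
private theorem hbs_aux {s : ℝ} (hs : 0 ≤ s) :
    MemLp (FunctionSpaces.Torus.stLift (fun τ => b (s + τ))) ∞ (volume.restrict (Ioo 0 (T - s) ×ˢ univ)) := by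
  have h := memLp_top_stLift_reversed_window (T := T) (b := b) hb hs le_rfl
  -- `memLp_top_stLift_reversed_window` gives the REVERSED carrier on `(0, T - s)`; reverse once more
  have h2 := memLp_top_stLift_reversed (t₀ := T - s) h le_rfl
  have e : (fun r => -(fun r => -b (T - r)) (T - s - r)) = fun τ => b (s + τ) := by
    funext r; show - -b (T - (T - s - r)) = b (s + r); rw [neg_neg]; congr 1; ring
  rw [e] at h2
  exact h2

/-- **(E2) DROP ≥ DISSIPATION, real form, at EVERY time.**  For `0 ≤ s < T`, `s ≤ t ≤ T`, `y ∈ L²`, with `w` the chosen Lions weak solution on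
`[s,T)` from `P_σ y` (`windowSol`; `U s t y` is the class of its weakly continuous representative at lag `t − s`, `coeFn_propagator`):
`‖U s t y‖² + 2·lo·∫₀^{t−s} ‖∇w(τ)‖² dτ ≤ ‖P_σ y‖²`.  The class's a.e. energy inequality (Temam III.1.2) holds at EVERY `t` because the values of
`U` are those of the weakly continuous representative: pairings `τ ↦ ∫⟪W τ, ψ⟫` are continuous, the dissipation primitive is continuous, an a.e.
inequality between continuous functions holds everywhere, and testing against `ψ = W(t − s)` itself closes. [cite: Temam1984, Ch. III §1 Lemma 1.2] -/
theorem propagator_energy_ineq_real {s t : ℝ} (hs : 0 ≤ s) (hsT : s < T) (hst : s ≤ t) (htT : t ≤ T)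
    (y : Lp (EuclideanSpace ℝ d) 2 (volume : Measure (UnitAddTorus d))) :
    ‖propagator h𝔸 hlo hb hbdiv s t y‖ ^ 2 +
        2 * lo * ∫ τ in (0 : ℝ)..(t - s), (FunctionSpaces.Torus.eGradNormSq
          (windowSol h𝔸 hlo hb hbdiv hs hsT (Lp.memLp ((divFreeL2 d).starProjection y)) (isWeaklyDivFree_starProjection y) τ)).toReal
      ≤ ‖(divFreeL2 d).starProjection y‖ ^ 2 := by
  set P := (divFreeL2 d).starProjection with hP
  have hy : MemLp ((P y : Lp (EuclideanSpace ℝ d) 2 volume) : UnitAddTorus d → EuclideanSpace ℝ d) 2 volume := Lp.memLp _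
  have hyd := isWeaklyDivFree_starProjection (d := d) y
  set w := windowSol h𝔸 hlo hb hbdiv hs hsT hy hyd with hw_def
  set W := windowRep h𝔸 hlo hb hbdiv hs hsT hy hyd with hW_def
  have hsol := windowSol_spec h𝔸 hlo hb hbdiv hs hsT hy hyd
  have R := windowRep_spec h𝔸 hlo hb hbdiv hs hsT hy hyd
  have hTs : 0 < T - s := sub_pos.2 hsT
  have hbs := hbs_aux (T := T) hb hs
  -- Step A: the dissipation density and its primitive
  set f : ℝ → ℝ≥0∞ := fun τ => FunctionSpaces.Torus.eGradNormSq (w τ) with hf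
  have hf_meas : AEMeasurable f (volume.restrict (Ioo 0 (T - s))) := hsol.aemeasurable_eGradNormSq'
  have hD := hsol.eVectorDissipation_lt_top h𝔸 hlo hy hyd hbs
  have hlint : ∫⁻ τ in Ioo 0 (T - s), f τ ≠ ⊤ := by
    intro htop
    apply hD.ne
    rw [eVectorDissipation, htop, ENNReal.mul_top (ENNReal.ofReal_pos.2 hlo).ne']
  set g : ℝ → ℝ := fun τ => (f τ).toReal with hg
  have hg_nn : ∀ τ, 0 ≤ g τ := fun τ => ENNReal.toReal_nonneg
  have hg_int : IntegrableOn g (Ioo 0 (T - s)) volume := integrable_toReal_of_lintegral_ne_top hf_meas hlint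
  have hg_int' : IntegrableOn g (uIcc 0 (T - s)) volume := by
    rw [uIcc_of_le hTs.le]
    exact hg_int.congr_set_ae Ioo_ae_eq_Icc.symm
  have hf_lt : ∀ᵐ τ ∂(volume.restrict (Ioo 0 (T - s))), f τ < ⊤ := ae_lt_top' hf_meas hlint
  set G : ℝ → ℝ := fun τ => ∫ r in (0 : ℝ)..τ, g r with hG
  have hG_cont : ContinuousOn G (Icc 0 (T - s)) := by
    have h := intervalIntegral.continuousOn_primitive_interval' hg_int'.intervalIntegrable
      (by rw [uIcc_of_le hTs.le]; exact ⟨le_rfl, hTs.le⟩)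
    rwa [uIcc_of_le hTs.le] at h
  have hG_nn : ∀ τ, 0 ≤ τ → 0 ≤ G τ := fun τ hτ => intervalIntegral.integral_nonneg hτ fun r _ => hg_nn r
  -- the dissipation functional in terms of `G`
  have hGD : ∀ τ ∈ Icc 0 (T - s), eVectorDissipation lo w 0 τ = ENNReal.ofReal (lo * G τ) := by
    intro τ hτ
    have hsub : Ioo 0 τ ⊆ Ioo 0 (T - s) := Ioo_subset_Ioo le_rfl hτ.2
    have hgi : IntegrableOn g (Ioo 0 τ) volume := hg_int.mono_set hsub
    have h1 : ∫⁻ r in Ioo 0 τ, f r = ∫⁻ r in Ioo 0 τ, ENNReal.ofReal (g r) := by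
      refine lintegral_congr_ae ?_
      filter_upwards [ae_restrict_of_ae_restrict_of_subset hsub hf_lt] with r hr
      rw [hg, ENNReal.ofReal_toReal hr.ne]
    have h2 : ∫⁻ r in Ioo 0 τ, ENNReal.ofReal (g r) = ENNReal.ofReal (∫ r in Ioo 0 τ, g r) :=
      (ofReal_integral_eq_lintegral_ofReal hgi (ae_of_all _ fun r => hg_nn r)).symm
    have h3 : ∫ r in Ioo 0 τ, g r = G τ := by
      rw [hG]; simp only
      rw [intervalIntegral.integral_of_le hτ.1, integral_Ioc_eq_integral_Ioo]
    rw [eVectorDissipation, h1, h2, h3, ← ENNReal.ofReal_mul hlo.le]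
  -- Step B: the a.e. energy inequality in real form, `e τ ≤ h τ := E₀ − 2 lo G τ`
  set E₀ : ℝ := ∫ x, ‖((P y : Lp (EuclideanSpace ℝ d) 2 volume) : UnitAddTorus d → EuclideanSpace ℝ d) x‖ ^ 2 with hE₀
  have hE₀nn : 0 ≤ E₀ := integral_nonneg fun x => sq_nonneg _
  set h : ℝ → ℝ := fun τ => E₀ - 2 * lo * G τ with hh
  have hh_cont : ContinuousOn h (Icc 0 (T - s)) := continuousOn_const.sub (continuousOn_const.mul hG_cont)
  have hae_en : ∀ᵐ τ ∂(volume.restrict (Ioo 0 (T - s))), (∫ x, ‖w τ x‖ ^ 2) ≤ h τ := by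
    filter_upwards [hsol.ae_energy_ineq h𝔸 hlo hy hyd hbs, ae_restrict_mem measurableSet_Ioo] with τ hτ hτI
    rw [hGD τ ⟨hτI.1.le, hτI.2.le⟩] at hτ
    have e1 : ENNReal.ofReal (∫ x, ‖w τ x‖ ^ 2) + 2 * ENNReal.ofReal (lo * G τ) =
        ENNReal.ofReal ((∫ x, ‖w τ x‖ ^ 2) + 2 * (lo * G τ)) := by
      rw [ENNReal.ofReal_add (integral_nonneg fun x => sq_nonneg _) (by positivity [hG_nn τ hτI.1.le]),
        ENNReal.ofReal_mul zero_le_two, ENNReal.ofReal_ofNat]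
    rw [e1] at hτ
    have h2 := (ENNReal.ofReal_le_ofReal_iff hE₀nn).1 hτ
    show (∫ x, ‖w τ x‖ ^ 2) ≤ E₀ - 2 * lo * G τ
    linarith
  -- Step C: for each `L²` test, the pairing bound holds at EVERY `τ ∈ [0, T − s]`; and `0 ≤ h`
  have hh_nn : ∀ τ ∈ Icc 0 (T - s), 0 ≤ h τ := by
    refine le_on_Icc_of_ae_le_of_continuousOn₂ hTs continuousOn_const hh_cont ?_
    filter_upwards [hae_en] with τ hτ
    exact (integral_nonneg fun x => sq_nonneg _).trans hτ
  have hpair : ∀ ψ : UnitAddTorus d → EuclideanSpace ℝ d, MemLp ψ 2 volume →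
      ∀ τ ∈ Icc 0 (T - s), |∫ x, ⟪W τ x, ψ x⟫_ℝ| ≤ Real.sqrt (h τ) * Real.sqrt (∫ x, ‖ψ x‖ ^ 2) := by
    intro ψ hψ
    refine le_on_Icc_of_ae_le_of_continuousOn₂ hTs ((R.2.2.2.2.2.1 ψ hψ).abs)
      ((Real.continuous_sqrt.comp_continuousOn hh_cont).mul continuousOn_const) ?_
    filter_upwards [hae_en, R.2.2.2.1, hsol.ae_memLp_two] with τ hτ hWτ hm
    have e1 : ∫ x, ⟪W τ x, ψ x⟫_ℝ = ∫ x, ⟪w τ x, ψ x⟫_ℝ :=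
      integral_congr_ae (hWτ.mono fun x hx => by
        show ⟪W τ x, ψ x⟫_ℝ = ⟪w τ x, ψ x⟫_ℝ
        rw [show W τ x = w τ x from hx])
    rw [e1]
    refine (abs_integral_inner_le_sqrt_mul_sqrt hm hψ).trans ?_
    gcongr
  -- Step D: test against `W τ₀` itself at `τ₀ = t − s`
  have hτ₀ : t - s ∈ Icc 0 (T - s) := ⟨sub_nonneg.2 hst, sub_le_sub_right htT s⟩
  have hWm : MemLp (W (t - s)) 2 volume := R.1 _ hτ₀.1
  set X : ℝ := ∫ x, ‖W (t - s) x‖ ^ 2 with hX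
  have hXnn : 0 ≤ X := integral_nonneg fun x => sq_nonneg _
  have hXle : X ≤ h (t - s) := by
    have h1 := hpair (W (t - s)) hWm (t - s) hτ₀
    have e1 : ∫ x, ⟪W (t - s) x, W (t - s) x⟫_ℝ = X :=
      integral_congr_ae (ae_of_all _ fun x => real_inner_self_eq_norm_sq _)
    rw [e1, abs_of_nonneg hXnn] at h1
    -- `X ≤ √h · √X` ⇒ `X ≤ h`
    have h0 := hh_nn _ hτ₀
    rcases hXnn.eq_or_lt with hX0 | hXpos
    · rw [← hX0]; exact h0
    · have h2 : Real.sqrt X * Real.sqrt X ≤ Real.sqrt (h (t - s)) * Real.sqrt X := by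
        rw [Real.mul_self_sqrt hXnn]; exact h1
      have h3 : Real.sqrt X ≤ Real.sqrt (h (t - s)) := le_of_mul_le_mul_right h2 (Real.sqrt_pos.2 hXpos)
      calc X = Real.sqrt X ^ 2 := (Real.sq_sqrt hXnn).symm
        _ ≤ Real.sqrt (h (t - s)) ^ 2 := by gcongr
        _ = h (t - s) := Real.sq_sqrt h0
  -- Step E: assemble
  have hUX : ‖propagator h𝔸 hlo hb hbdiv s t y‖ ^ 2 = X := by
    rw [propagator_apply_eq h𝔸 hlo hb hbdiv hs hsT hst htT]
    unfold windowMapFun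
    exact norm_toLp_sq' _
  have hPy : ‖P y‖ ^ 2 = E₀ := by
    rw [hE₀, ← norm_toLp_sq' hy, Lp.toLp_coeFn]
  rw [hUX, hPy]
  have : X ≤ E₀ - 2 * lo * G (t - s) := hXle
  linarith

/-- **(E2) DROP ≥ DISSIPATION, `ℝ≥0∞` form**: `ofReal ‖U s t y‖² + 2·eVectorDissipation lo w 0 (t − s) ≤ ofReal ‖P_σ y‖²`.
[cite: Temam1984, Ch. III §1 Lemma 1.2] -/
theorem propagator_energy_ineq {s t : ℝ} (hs : 0 ≤ s) (hsT : s < T) (hst : s ≤ t) (htT : t ≤ T)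
    (y : Lp (EuclideanSpace ℝ d) 2 (volume : Measure (UnitAddTorus d))) :
    ENNReal.ofReal (‖propagator h𝔸 hlo hb hbdiv s t y‖ ^ 2) +
        2 * eVectorDissipation lo
          (windowSol h𝔸 hlo hb hbdiv hs hsT (Lp.memLp ((divFreeL2 d).starProjection y)) (isWeaklyDivFree_starProjection y)) 0 (t - s)
      ≤ ENNReal.ofReal (‖(divFreeL2 d).starProjection y‖ ^ 2) := by
  -- same bookkeeping as the real form, read in `ℝ≥0∞`
  set P := (divFreeL2 d).starProjection with hP
  have hy : MemLp ((P y : Lp (EuclideanSpace ℝ d) 2 volume) : UnitAddTorus d → EuclideanSpace ℝ d) 2 volume := Lp.memLp _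
  have hyd := isWeaklyDivFree_starProjection (d := d) y
  set w := windowSol h𝔸 hlo hb hbdiv hs hsT hy hyd with hw_def
  have hsol := windowSol_spec h𝔸 hlo hb hbdiv hs hsT hy hyd
  have hTs : 0 < T - s := sub_pos.2 hsT
  have hbs := hbs_aux (T := T) hb hs
  set f : ℝ → ℝ≥0∞ := fun τ => FunctionSpaces.Torus.eGradNormSq (w τ) with hf
  have hf_meas : AEMeasurable f (volume.restrict (Ioo 0 (T - s))) := hsol.aemeasurable_eGradNormSq'
  have hD := hsol.eVectorDissipation_lt_top h𝔸 hlo hy hyd hbs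
  have hlint : ∫⁻ τ in Ioo 0 (T - s), f τ ≠ ⊤ := by
    intro htop
    apply hD.ne
    rw [eVectorDissipation, htop, ENNReal.mul_top (ENNReal.ofReal_pos.2 hlo).ne']
  set g : ℝ → ℝ := fun τ => (f τ).toReal with hg
  have hg_nn : ∀ τ, 0 ≤ g τ := fun τ => ENNReal.toReal_nonneg
  have hg_int : IntegrableOn g (Ioo 0 (T - s)) volume := integrable_toReal_of_lintegral_ne_top hf_meas hlint
  have hf_lt : ∀ᵐ τ ∂(volume.restrict (Ioo 0 (T - s))), f τ < ⊤ := ae_lt_top' hf_meas hlint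
  have hτ₀ : t - s ∈ Icc 0 (T - s) := ⟨sub_nonneg.2 hst, sub_le_sub_right htT s⟩
  have hsub : Ioo 0 (t - s) ⊆ Ioo 0 (T - s) := Ioo_subset_Ioo le_rfl hτ₀.2
  have hgi : IntegrableOn g (Ioo 0 (t - s)) volume := hg_int.mono_set hsub
  have hGD : eVectorDissipation lo w 0 (t - s) = ENNReal.ofReal (lo * ∫ r in (0 : ℝ)..(t - s), g r) := by
    have h1 : ∫⁻ r in Ioo 0 (t - s), f r = ∫⁻ r in Ioo 0 (t - s), ENNReal.ofReal (g r) := by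
      refine lintegral_congr_ae ?_
      filter_upwards [ae_restrict_of_ae_restrict_of_subset hsub hf_lt] with r hr
      rw [hg, ENNReal.ofReal_toReal hr.ne]
    have h2 : ∫⁻ r in Ioo 0 (t - s), ENNReal.ofReal (g r) = ENNReal.ofReal (∫ r in Ioo 0 (t - s), g r) :=
      (ofReal_integral_eq_lintegral_ofReal hgi (ae_of_all _ fun r => hg_nn r)).symm
    rw [eVectorDissipation, h1, h2, intervalIntegral.integral_of_le hτ₀.1, integral_Ioc_eq_integral_Ioo, ← ENNReal.ofReal_mul hlo.le]
  have hreal := propagator_energy_ineq_real h𝔸 hlo hb hbdiv hs hsT hst htT y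
  have hGnn : 0 ≤ ∫ r in (0 : ℝ)..(t - s), g r := intervalIntegral.integral_nonneg hτ₀.1 fun r _ => hg_nn r
  have e1 : ENNReal.ofReal (‖propagator h𝔸 hlo hb hbdiv s t y‖ ^ 2) + 2 * ENNReal.ofReal (lo * ∫ r in (0 : ℝ)..(t - s), g r) =
      ENNReal.ofReal (‖propagator h𝔸 hlo hb hbdiv s t y‖ ^ 2 + 2 * (lo * ∫ r in (0 : ℝ)..(t - s), g r)) := by
    rw [ENNReal.ofReal_add (sq_nonneg _) (by positivity), ENNReal.ofReal_mul zero_le_two, ENNReal.ofReal_ofNat]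
  rw [hGD, e1]
  exact ENNReal.ofReal_le_ofReal (by linarith [hreal])

/-- **(E3) FAST-MODE KILL (propagator side), `ℝ≥0∞` form**: for every `N`,
`2·lo·(4π²N²)·∫₀^{t−s} ‖w(τ) − P_N w(τ)‖²_{L²} dτ ≤ ‖P_σ y‖² − ‖U s t y‖²` — the drop of the window controls the time-integrated energy above
the Fourier ball (spectral gap `4π²N²‖u − P_N u‖² ≤ ‖∇u‖²` under (E2)). [cite: Temam1984, Ch. III §1 Lemma 1.2] -/
theorem propagator_fast_kill {s t : ℝ} (hs : 0 ≤ s) (hsT : s < T) (hst : s ≤ t) (htT : t ≤ T)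
    (y : Lp (EuclideanSpace ℝ d) 2 (volume : Measure (UnitAddTorus d))) (N : ℕ) :
    2 * ENNReal.ofReal lo * (ENNReal.ofReal (4 * Real.pi ^ 2 * (N : ℝ) ^ 2) *
        ∫⁻ τ in Ioo 0 (t - s), ∫⁻ x, ‖windowSol h𝔸 hlo hb hbdiv hs hsT (Lp.memLp ((divFreeL2 d).starProjection y))
            (isWeaklyDivFree_starProjection y) τ x -
          FunctionSpaces.Torus.fourierTruncate N (windowSol h𝔸 hlo hb hbdiv hs hsT (Lp.memLp ((divFreeL2 d).starProjection y))
            (isWeaklyDivFree_starProjection y) τ) x‖ₑ ^ 2)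
      ≤ ENNReal.ofReal (‖(divFreeL2 d).starProjection y‖ ^ 2 - ‖propagator h𝔸 hlo hb hbdiv s t y‖ ^ 2) := by
  set P := (divFreeL2 d).starProjection with hP
  have hy : MemLp ((P y : Lp (EuclideanSpace ℝ d) 2 volume) : UnitAddTorus d → EuclideanSpace ℝ d) 2 volume := Lp.memLp _
  have hyd := isWeaklyDivFree_starProjection (d := d) y
  set w := windowSol h𝔸 hlo hb hbdiv hs hsT hy hyd with hw_def
  have hsol := windowSol_spec h𝔸 hlo hb hbdiv hs hsT hy hyd
  have hE := propagator_energy_ineq h𝔸 hlo hb hbdiv hs hsT hst htT y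
  have hsub : Ioo 0 (t - s) ⊆ Ioo 0 (T - s) := Ioo_subset_Ioo le_rfl (sub_le_sub_right htT s)
  -- pointwise-in-time spectral gap, a.e. (where `w τ ∈ L²`)
  have hgap : ∀ᵐ τ ∂(volume.restrict (Ioo 0 (t - s))),
      ENNReal.ofReal (4 * Real.pi ^ 2 * (N : ℝ) ^ 2) * ∫⁻ x, ‖w τ x - FunctionSpaces.Torus.fourierTruncate N (w τ) x‖ₑ ^ 2 ≤
        FunctionSpaces.Torus.eGradNormSq (w τ) := by
    filter_upwards [ae_restrict_of_ae_restrict_of_subset hsub hsol.ae_memLp_two] with τ hm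
    exact ofReal_mul_lintegral_sub_fourierTruncate_le_eGradNormSq hm N
  have h1 : ENNReal.ofReal (4 * Real.pi ^ 2 * (N : ℝ) ^ 2) *
      ∫⁻ τ in Ioo 0 (t - s), ∫⁻ x, ‖w τ x - FunctionSpaces.Torus.fourierTruncate N (w τ) x‖ₑ ^ 2 ≤
        ∫⁻ τ in Ioo 0 (t - s), FunctionSpaces.Torus.eGradNormSq (w τ) := by
    rw [← lintegral_const_mul' _ _ ENNReal.ofReal_ne_top]
    exact lintegral_mono_ae hgap
  have h2 : 2 * ENNReal.ofReal lo * (ENNReal.ofReal (4 * Real.pi ^ 2 * (N : ℝ) ^ 2) *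
      ∫⁻ τ in Ioo 0 (t - s), ∫⁻ x, ‖w τ x - FunctionSpaces.Torus.fourierTruncate N (w τ) x‖ₑ ^ 2) ≤
        2 * eVectorDissipation lo w 0 (t - s) := by
    rw [eVectorDissipation, mul_assoc]
    gcongr
  refine h2.trans ?_
  have hfin : ENNReal.ofReal (‖propagator h𝔸 hlo hb hbdiv s t y‖ ^ 2) ≠ ⊤ := ENNReal.ofReal_ne_top
  have h3 := ENNReal.le_sub_of_add_le_left hfin hE
  rw [← ENNReal.ofReal_sub _ (sq_nonneg _)] at h3
  exact h3

end Energy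

/-! ## Transfer to any `IsPropagator` family -/

namespace IsPropagator

variable {U : ℝ → ℝ → (Lp (EuclideanSpace ℝ d) 2 (volume : Measure (UnitAddTorus d)) →L[ℝ]
  Lp (EuclideanSpace ℝ d) 2 (volume : Measure (UnitAddTorus d)))}

/-- **(E2) for any `IsPropagator` family** (the spec determines `U`, `IsPropagator.eq_propagator`): real form. [cite: Temam1984, Ch. III §1 Lemma 1.2] -/
theorem energy_ineq_real (hU : IsPropagator T b 𝔸 U) (h𝔸 : NearIso 𝔸 lo hi) (hlo : 0 < lo)
    (hb : MemLp (FunctionSpaces.Torus.stLift b) ∞ (volume.restrict (Ioo 0 T ×ˢ univ)))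
    (hbdiv : ∀ᵐ τ ∂(volume.restrict (Ioo 0 T)), FunctionSpaces.Torus.IsWeaklyDivFree (b τ))
    {s t : ℝ} (hs : 0 ≤ s) (hsT : s < T) (hst : s ≤ t) (htT : t ≤ T)
    (y : Lp (EuclideanSpace ℝ d) 2 (volume : Measure (UnitAddTorus d))) :
    ‖U s t y‖ ^ 2 +
        2 * lo * ∫ τ in (0 : ℝ)..(t - s), (FunctionSpaces.Torus.eGradNormSq
          (windowSol h𝔸 hlo hb hbdiv hs hsT (Lp.memLp ((divFreeL2 d).starProjection y)) (isWeaklyDivFree_starProjection y) τ)).toReal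
      ≤ ‖(divFreeL2 d).starProjection y‖ ^ 2 := by
  rw [hU.eq_propagator h𝔸 hlo hb hbdiv hs hst htT y]
  exact propagator_energy_ineq_real h𝔸 hlo hb hbdiv hs hsT hst htT y

/-- **(E2) for any `IsPropagator` family**, `ℝ≥0∞` form. [cite: Temam1984, Ch. III §1 Lemma 1.2] -/
theorem energy_ineq (hU : IsPropagator T b 𝔸 U) (h𝔸 : NearIso 𝔸 lo hi) (hlo : 0 < lo)
    (hb : MemLp (FunctionSpaces.Torus.stLift b) ∞ (volume.restrict (Ioo 0 T ×ˢ univ)))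
    (hbdiv : ∀ᵐ τ ∂(volume.restrict (Ioo 0 T)), FunctionSpaces.Torus.IsWeaklyDivFree (b τ))
    {s t : ℝ} (hs : 0 ≤ s) (hsT : s < T) (hst : s ≤ t) (htT : t ≤ T)
    (y : Lp (EuclideanSpace ℝ d) 2 (volume : Measure (UnitAddTorus d))) :
    ENNReal.ofReal (‖U s t y‖ ^ 2) +
        2 * eVectorDissipation lo
          (windowSol h𝔸 hlo hb hbdiv hs hsT (Lp.memLp ((divFreeL2 d).starProjection y)) (isWeaklyDivFree_starProjection y)) 0 (t - s)
      ≤ ENNReal.ofReal (‖(divFreeL2 d).starProjection y‖ ^ 2) := by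
  rw [hU.eq_propagator h𝔸 hlo hb hbdiv hs hst htT y]
  exact propagator_energy_ineq h𝔸 hlo hb hbdiv hs hsT hst htT y

/-- **(E3) for any `IsPropagator` family**: fast-mode kill on the window. [cite: Temam1984, Ch. III §1 Lemma 1.2] -/
theorem fast_kill (hU : IsPropagator T b 𝔸 U) (h𝔸 : NearIso 𝔸 lo hi) (hlo : 0 < lo)
    (hb : MemLp (FunctionSpaces.Torus.stLift b) ∞ (volume.restrict (Ioo 0 T ×ˢ univ)))
    (hbdiv : ∀ᵐ τ ∂(volume.restrict (Ioo 0 T)), FunctionSpaces.Torus.IsWeaklyDivFree (b τ))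
    {s t : ℝ} (hs : 0 ≤ s) (hsT : s < T) (hst : s ≤ t) (htT : t ≤ T)
    (y : Lp (EuclideanSpace ℝ d) 2 (volume : Measure (UnitAddTorus d))) (N : ℕ) :
    2 * ENNReal.ofReal lo * (ENNReal.ofReal (4 * Real.pi ^ 2 * (N : ℝ) ^ 2) *
        ∫⁻ τ in Ioo 0 (t - s), ∫⁻ x, ‖windowSol h𝔸 hlo hb hbdiv hs hsT (Lp.memLp ((divFreeL2 d).starProjection y))
            (isWeaklyDivFree_starProjection y) τ x -
          FunctionSpaces.Torus.fourierTruncate N (windowSol h𝔸 hlo hb hbdiv hs hsT (Lp.memLp ((divFreeL2 d).starProjection y))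
            (isWeaklyDivFree_starProjection y) τ) x‖ₑ ^ 2)
      ≤ ENNReal.ofReal (‖(divFreeL2 d).starProjection y‖ ^ 2 - ‖U s t y‖ ^ 2) := by
  rw [hU.eq_propagator h𝔸 hlo hb hbdiv hs hst htT y]
  exact propagator_fast_kill h𝔸 hlo hb hbdiv hs hsT hst htT y N

/-- **(E2′) real form against `‖y‖²`** (`‖P_σ y‖ ≤ ‖y‖`): `‖U s t y‖² + 2·lo·∫₀^{t−s}‖∇w‖² ≤ ‖y‖²`. [cite: Temam1984, Ch. III §1 Lemma 1.2] -/
theorem energy_ineq_real' (hU : IsPropagator T b 𝔸 U) (h𝔸 : NearIso 𝔸 lo hi) (hlo : 0 < lo)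
    (hb : MemLp (FunctionSpaces.Torus.stLift b) ∞ (volume.restrict (Ioo 0 T ×ˢ univ)))
    (hbdiv : ∀ᵐ τ ∂(volume.restrict (Ioo 0 T)), FunctionSpaces.Torus.IsWeaklyDivFree (b τ))
    {s t : ℝ} (hs : 0 ≤ s) (hsT : s < T) (hst : s ≤ t) (htT : t ≤ T)
    (y : Lp (EuclideanSpace ℝ d) 2 (volume : Measure (UnitAddTorus d))) :
    ‖U s t y‖ ^ 2 +
        2 * lo * ∫ τ in (0 : ℝ)..(t - s), (FunctionSpaces.Torus.eGradNormSq
          (windowSol h𝔸 hlo hb hbdiv hs hsT (Lp.memLp ((divFreeL2 d).starProjection y)) (isWeaklyDivFree_starProjection y) τ)).toReal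
      ≤ ‖y‖ ^ 2 := by
  have h1 := hU.energy_ineq_real h𝔸 hlo hb hbdiv hs hsT hst htT y
  have h2 : ‖(divFreeL2 d).starProjection y‖ ^ 2 ≤ ‖y‖ ^ 2 := by
    have h := (divFreeL2 d).norm_starProjection_apply_le y
    exact pow_le_pow_left₀ (norm_nonneg _) h 2
  exact h1.trans h2

/-- **(E3′) FAST-MODE KILL, real form against `‖y‖²`**: for every `N`,
`2·lo·(4π²N²)·(∫⁻ τ∈(0,t−s) ∫⁻ ‖w τ − P_N(w τ)‖ₑ²).toReal ≤ ‖y‖² − ‖U s t y‖²` (the double `lintegral` is finite, being bounded by the drop).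
[cite: Temam1984, Ch. III §1 Lemma 1.2] -/
theorem fast_kill_real (hU : IsPropagator T b 𝔸 U) (h𝔸 : NearIso 𝔸 lo hi) (hlo : 0 < lo)
    (hb : MemLp (FunctionSpaces.Torus.stLift b) ∞ (volume.restrict (Ioo 0 T ×ˢ univ)))
    (hbdiv : ∀ᵐ τ ∂(volume.restrict (Ioo 0 T)), FunctionSpaces.Torus.IsWeaklyDivFree (b τ))
    {s t : ℝ} (hs : 0 ≤ s) (hsT : s < T) (hst : s ≤ t) (htT : t ≤ T)
    (y : Lp (EuclideanSpace ℝ d) 2 (volume : Measure (UnitAddTorus d))) (N : ℕ) :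
    2 * lo * (4 * Real.pi ^ 2 * (N : ℝ) ^ 2) *
        (∫⁻ τ in Ioo 0 (t - s), ∫⁻ x, ‖windowSol h𝔸 hlo hb hbdiv hs hsT (Lp.memLp ((divFreeL2 d).starProjection y))
            (isWeaklyDivFree_starProjection y) τ x -
          FunctionSpaces.Torus.fourierTruncate N (windowSol h𝔸 hlo hb hbdiv hs hsT (Lp.memLp ((divFreeL2 d).starProjection y))
            (isWeaklyDivFree_starProjection y) τ) x‖ₑ ^ 2).toReal
      ≤ ‖y‖ ^ 2 - ‖U s t y‖ ^ 2 := by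
  have h := hU.fast_kill h𝔸 hlo hb hbdiv hs hsT hst htT y N
  set I := ∫⁻ τ in Ioo 0 (t - s), ∫⁻ x, ‖windowSol h𝔸 hlo hb hbdiv hs hsT (Lp.memLp ((divFreeL2 d).starProjection y))
            (isWeaklyDivFree_starProjection y) τ x -
          FunctionSpaces.Torus.fourierTruncate N (windowSol h𝔸 hlo hb hbdiv hs hsT (Lp.memLp ((divFreeL2 d).starProjection y))
            (isWeaklyDivFree_starProjection y) τ) x‖ₑ ^ 2 with hI
  have hP : ‖(divFreeL2 d).starProjection y‖ ^ 2 ≤ ‖y‖ ^ 2 :=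
    pow_le_pow_left₀ (norm_nonneg _) ((divFreeL2 d).norm_starProjection_apply_le y) 2
  -- the left side of `h` is finite
  have hc : 2 * ENNReal.ofReal lo * ENNReal.ofReal (4 * Real.pi ^ 2 * (N : ℝ) ^ 2) =
      ENNReal.ofReal (2 * lo * (4 * Real.pi ^ 2 * (N : ℝ) ^ 2)) := by
    rw [ENNReal.ofReal_mul (by positivity : (0 : ℝ) ≤ 2 * lo), ENNReal.ofReal_mul zero_le_two, ENNReal.ofReal_ofNat]
  have h' : ENNReal.ofReal (2 * lo * (4 * Real.pi ^ 2 * (N : ℝ) ^ 2)) * I ≤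
      ENNReal.ofReal (‖(divFreeL2 d).starProjection y‖ ^ 2 - ‖U s t y‖ ^ 2) := by
    rw [← hc, mul_assoc]; exact h
  by_cases hc0 : 2 * lo * (4 * Real.pi ^ 2 * (N : ℝ) ^ 2) = 0
  · rw [hc0, zero_mul]
    have := hU.norm_apply_le_of_le hs le_rfl hst htT y
    have h0 : ‖U s s y‖ ≤ ‖y‖ := hU.norm_le _ _ _
    nlinarith [norm_nonneg (U s t y), norm_nonneg y]
  · have hcpos : 0 < 2 * lo * (4 * Real.pi ^ 2 * (N : ℝ) ^ 2) := lt_of_le_of_ne (by positivity) (Ne.symm hc0)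
    have hIfin : I ≠ ⊤ := by
      intro htop
      rw [htop, ENNReal.mul_top (ENNReal.ofReal_pos.2 hcpos).ne'] at h'
      exact ENNReal.ofReal_ne_top (top_le_iff.1 h')
    have h2 := ENNReal.toReal_mono ENNReal.ofReal_ne_top h'
    rw [ENNReal.toReal_mul, ENNReal.toReal_ofReal hcpos.le] at h2
    have h3 : (ENNReal.ofReal (‖(divFreeL2 d).starProjection y‖ ^ 2 - ‖U s t y‖ ^ 2)).toReal ≤ ‖y‖ ^ 2 - ‖U s t y‖ ^ 2 := by
      rcases le_or_gt 0 (‖(divFreeL2 d).starProjection y‖ ^ 2 - ‖U s t y‖ ^ 2) with hnn | hneg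
      · rw [ENNReal.toReal_ofReal hnn]; linarith
      · rw [ENNReal.ofReal_of_nonpos hneg.le, ENNReal.toReal_zero]
        have := hU.norm_le s t y
        nlinarith [norm_nonneg (U s t y), norm_nonneg y]
    exact h2.trans h3

end IsPropagator

end Torus

end Literature.Analysis.FluidPDE

end
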